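import Summits.HubbardSuperconductivity.HubbardSuperconductivity.Theorems.CwSsbToEvenTorusLRO.Negative.RepelledOrderCeiling
import Summits.HubbardSuperconductivity.HubbardSuperconductivity.Theorems.WeakCouplingBCSWcbcsBcsConstructionHamiltonianNormBound
import Literature.MathematicalPhysics.QuantumLattice.BdGBondHamiltonianTorus

/-!
# Crux `CwSsbToEvenTorusLRO` (item `stmt-HubbardSuperconductivity-10439`): stub `stub_repelledOrderPersistence` (S2) of
line `griffiths-block-slope` under the adversary — file 2 of 2: explicit energy-density bound, the `∀κ` strengthening
refuted, Transfer B in the two-phase caricature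

Continues `Negative/RepelledOrderCeiling.lean` (generation 3 of the standing disprover). On the literal terms of the
stub (no definitions):

* `neg_groundEnergy_dWaveSourceTorus_le` — `-E₀(T_h) ≤ (10(1+U+|μ|) + 12|h|)L²` for `U ≥ 0` (explicit constants: the
  landed `stub_hamiltonianNormBound` count `≤ 5L²` local terms of norm `≤ 2 + U + 2|μ|`, and `‖P‖ ≤ 6L²` from
  `Σ_{e ∈ {0,±e₁,±e₂}} |d(e)/√2| = 4/√2`);
* `repelled_pairDensity_lt_of_large_coupling` — UNCONDITIONAL: at `κ ≥ (10(1+U+|μ|)+13)/a²` the sourced tracial pair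
  density of the block-repelled torus `T_h + κW_R` is `< a` at EVERY side `L ≥ 1`, scale `R ≥ 1`, `h ∈ [0,1]`; so an
  `R`-uniform floor `a` as in S2 pins `κ(R)` below `(10(1+U+|μ|)+13)/a²`;
* `forallKappa_repelledOrder_false_of_construction` — the strengthening of S2 with `∀ κ > 0` in place of `∃ κ > 0`,
  in S2's literal shape, is refuted MODULO crux 2 `CwChiralConstruction` (which supplies a guarded triple
  `(U, δ, μ)`); S2 itself is untouched (negative lemma on a strengthening);
* `transferB_unrepelled_selects_rich`, `transferB_repelled_selects_poor`, `transferB_fails_at_scNormal_coexistence`,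
  `transferB_holds_at_scSc_coexistence`, `transferB_shape_at_scSc_coexistence` — the TWO-PHASE CARICATURE of Transfer B
  at a coexistence point (two phases of equal energy density, sourced repelled energies `-2h mᵢ + κ wᵢ`,
  `m₁ > m₂ ≥ 0`, `w₁ > w₂`): at `κ = 0` the source selects the `B1g`-rich phase for every `h > 0` (the `HasDWaveOrder`
  side), but for EVERY `κ > 0` the repelled model selects the block-poorer phase once `2h(m₁ - m₂) < κ(w₁ - w₂)`; so
  the S2 shape `∃ a > 0, ∃ κ > 0, ∃ h₀ > 0, ∀ h ∈ (0,h₀), a ≤ m_sel(h,κ)` FAILS iff `m₂ = 0` (SC/normal coexistence —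
  the crux's own kill configuration, plus the equal-density codimension-2 case where the crux survives) and HOLDS with
  `a = m₂` when `m₂ > 0` (SC/SC coexistence: Transfer B tolerates SC–SC kinks, where Transfer A's `NoBlockKink` fails
  by `coexistence_defeats_encoding`).

Folklore norm bookkeeping and real arithmetic. Workfile: `Cruxes/CwSsbToEvenTorusLRO/Disproof.lean` §6c'–§6d (gen 3).
-/

noncomputable section

namespace Summit.HubbardSuperconductivity.HubbardSuperconductivity.Theorems.CwSsbToEvenTorusLRO.Negative

open Matrix Literature.MathematicalPhysics.QuantumLattice
open Literature.Probability.LatticeModels (TorusSite Site)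
open Filter Set
open scoped Matrix ComplexOrder Matrix.Norms.L2Operator
open _root_.Topology

/-! ### 1. Explicit energy-density bound; the `∀κ` strengthening of S2 refuted (unconditionally in density form,
and in S2's literal shape modulo crux 2 `CwChiralConstruction`) -/

section KappaThreshold

variable (L : ℕ) [NeZero L]

omit [NeZero L] in
/-- `Σ_{e ∈ {0, ±e₁, ±e₂}} |d(e)/√2| = 4/√2`. [folklore] -/
theorem sum_abs_dWaveFormFactor_div_sqrt_two_eq :
    ∑ e ∈ insert (0 : Site 2) unitSteps, |dWaveFormFactor e / Real.sqrt 2| = 4 / Real.sqrt 2 := by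
  rw [Finset.sum_insert zero_not_mem_unitSteps, sum_unitSteps, dWaveFormFactor_zero,
    dWaveFormFactor_unitStep, dWaveFormFactor_neg_unitStep, dWaveFormFactor_unitStep,
    dWaveFormFactor_neg_unitStep]
  simp only [Fin.isValue, if_true, one_ne_zero, if_false, zero_div, abs_zero, zero_add]
  have hs : 0 < Real.sqrt 2 := Real.sqrt_pos.2 two_pos
  rw [abs_div, abs_div, abs_one, abs_neg, abs_one, abs_of_pos hs]
  ring

/-- `‖P‖ ≤ 6L²` for the `d`-wave pair field (`2 · 4/√2 = 4√2 ≤ 6`). [folklore] -/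
theorem norm_pairField_dWaveFormFactor_le_six : ‖pairField dWaveFormFactor L‖ ≤ 6 * (L : ℝ) ^ 2 := by
  have h := norm_pairField_le dWaveFormFactor L
  rw [sum_abs_dWaveFormFactor_div_sqrt_two_eq] at h
  have hs : 0 < Real.sqrt 2 := Real.sqrt_pos.2 two_pos
  have hs2 : Real.sqrt 2 ^ 2 = 2 := Real.sq_sqrt two_pos.le
  have hc : 2 * (4 / Real.sqrt 2) ≤ 6 := by
    rw [mul_div_assoc', div_le_iff₀ hs]
    nlinarith [hs2, hs]
  have hL : (0 : ℝ) ≤ (L : ℝ) ^ 2 := by positivity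
  exact h.trans (mul_le_mul_of_nonneg_right hc hL)

/-- `‖K_μ‖ ≤ 10(1 + U + |μ|)L²` for `U ≥ 0` (explicit-constant form of the landed `stub_hamiltonianNormBound`: at most
`5L²` local terms of norm `≤ 2 + U + 2|μ|`). [folklore] -/
theorem norm_hubbardTorusWith_le_ten (U μ : ℝ) (hU : 0 ≤ U) :
    ‖hubbardTorusWith 2 L 1 U μ‖ ≤ 10 * (1 + U + |μ|) * (L : ℝ) ^ 2 := by
  have hcard : (Fintype.card (HubbardIdx (fermionTorusGraph 2 L)) : ℝ) ≤ 5 * (L : ℝ) ^ 2 := by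
    exact_mod_cast card_hubbardIdx_fermionTorus_two_le L
  have hterm : 2 * |(1 : ℝ)| + |U| + 2 * |μ| ≤ 2 * (1 + U + |μ|) := by
    rw [abs_one, abs_of_nonneg hU]
    linarith
  rw [hubbardTorusWith, ← sum_hubbardTermOp]
  calc ‖∑ Z, hubbardTermOp (fermionTorusGraph 2 L) 1 U μ Z‖
      ≤ ∑ Z, ‖hubbardTermOp (fermionTorusGraph 2 L) 1 U μ Z‖ := norm_sum_le _ _
    _ ≤ ∑ _Z : HubbardIdx (fermionTorusGraph 2 L), 2 * (1 + U + |μ|) :=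
        Finset.sum_le_sum fun Z _ => (norm_hubbardTermOp_le _ 1 U μ Z).trans hterm
    _ = (Fintype.card (HubbardIdx (fermionTorusGraph 2 L)) : ℝ) * (2 * (1 + U + |μ|)) := by
        rw [Finset.sum_const, nsmul_eq_mul, Finset.card_univ]
    _ ≤ (5 * (L : ℝ) ^ 2) * (2 * (1 + U + |μ|)) :=
        mul_le_mul_of_nonneg_right hcard (by positivity)
    _ = 10 * (1 + U + |μ|) * (L : ℝ) ^ 2 := by ring

/-- `‖T_h‖ ≤ (10(1 + U + |μ|) + 12|h|)L²` (`U ≥ 0`). [folklore] -/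
theorem norm_dWaveSourceTorus_le (U μ h : ℝ) (hU : 0 ≤ U) :
    ‖dWaveSourceTorus L U μ h‖ ≤ (10 * (1 + U + |μ|) + 12 * |h|) * (L : ℝ) ^ 2 := by
  rw [dWaveSourceTorus_eq]
  refine (norm_sub_le _ _).trans ?_
  have h1 := norm_hubbardTorusWith_le_ten L U μ hU
  have hP := norm_pairField_dWaveFormFactor_le_six L
  have hadd : ‖pairField dWaveFormFactor L + (pairField dWaveFormFactor L)ᴴ‖ ≤ 12 * (L : ℝ) ^ 2 := by
    refine (norm_add_le _ _).trans ?_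
    rw [Matrix.l2_opNorm_conjTranspose]
    linarith
  have h2 : ‖(h : ℂ) • (pairField dWaveFormFactor L + (pairField dWaveFormFactor L)ᴴ)‖ ≤ 12 * |h| * (L : ℝ) ^ 2 := by
    rw [norm_smul, Complex.norm_real, Real.norm_eq_abs]
    calc |h| * ‖pairField dWaveFormFactor L + (pairField dWaveFormFactor L)ᴴ‖ ≤ |h| * (12 * (L : ℝ) ^ 2) :=
          mul_le_mul_of_nonneg_left hadd (abs_nonneg h)
      _ = 12 * |h| * (L : ℝ) ^ 2 := by ring
  calc ‖hubbardTorusWith 2 L 1 U μ‖ + ‖(h : ℂ) • (pairField dWaveFormFactor L + (pairField dWaveFormFactor L)ᴴ)‖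
      ≤ 10 * (1 + U + |μ|) * (L : ℝ) ^ 2 + 12 * |h| * (L : ℝ) ^ 2 := add_le_add h1 h2
    _ = (10 * (1 + U + |μ|) + 12 * |h|) * (L : ℝ) ^ 2 := by ring

/-- **The sourced energy density is bounded below**: `-E₀(T_h) ≤ (10(1 + U + |μ|) + 12|h|)L²` (`U ≥ 0`). [folklore] -/
theorem neg_groundEnergy_dWaveSourceTorus_le (U μ h : ℝ) (hU : 0 ≤ U) :
    -(dWaveSourceTorus L U μ h).groundEnergy ≤ (10 * (1 + U + |μ|) + 12 * |h|) * (L : ℝ) ^ 2 := by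
  have hT := dWaveSourceTorus_isHermitian L (isHermitian_hubbardTorusWith L 1 U μ) h
  have h1 := abs_re_groundStateFunctional_le_norm hT (dWaveSourceTorus L U μ h)
  rw [groundStateFunctional_hamiltonian hT, Complex.ofReal_re] at h1
  have := (abs_le.mp h1).1
  linarith [norm_dWaveSourceTorus_le L U μ h hU]

/-- **Large block repulsion kills the sourced pair density, uniformly in `L` and `h ∈ [0,1]`** (UNCONDITIONAL):
at coupling `κ ≥ (10(1+U+|μ|) + 13)/a²` the sourced tracial pair density of `T_h + κW_R` is `< a`, for every side
`L ≥ 1`, scale `R ≥ 1`, `U ≥ 0`, `μ`. So an `R`-uniform floor `a` as in S2 pins `κ(R)` below `(10(1+U+|μ|)+13)/a²`: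
the strengthening of S2 with `∀ κ > 0` in place of `∃ κ > 0` is false at EVERY guarded triple. [folklore] -/
theorem repelled_pairDensity_lt_of_large_coupling (R : ℕ) (hR : 0 < R) {U : ℝ} (hU : 0 ≤ U) (μ : ℝ)
    {h : ℝ} (hh : h ∈ Set.Icc (0:ℝ) 1) {a : ℝ} (ha : 0 < a) {κ : ℝ} (hκ : (10 * (1 + U + |μ|) + 13) / a ^ 2 ≤ κ) :
    ((dWaveSourceTorus L U μ h + (κ : ℂ) • (((((R : ℝ) ^ 4)⁻¹ : ℝ) : ℂ) • ∑ a : TorusSite 2 L,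
        (∑ u : Fin 2 → Fin R, localPair dWaveFormFactor L (a + fun i => ((u i : ℕ) : ZMod L)))ᴴ *
          (∑ u : Fin 2 → Fin R, localPair dWaveFormFactor L (a + fun i => ((u i : ℕ) : ZMod L))))).groundStateFunctional
        (pairField dWaveFormFactor L)).re / (L : ℝ) ^ 2 < a := by
  set x : ℝ := ((dWaveSourceTorus L U μ h + (κ : ℂ) • (((((R : ℝ) ^ 4)⁻¹ : ℝ) : ℂ) • ∑ a : TorusSite 2 L,
        (∑ u : Fin 2 → Fin R, localPair dWaveFormFactor L (a + fun i => ((u i : ℕ) : ZMod L)))ᴴ *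
          (∑ u : Fin 2 → Fin R, localPair dWaveFormFactor L (a + fun i => ((u i : ℕ) : ZMod L))))).groundStateFunctional
        (pairField dWaveFormFactor L)).re with hx
  have hL : (0 : ℝ) < (L : ℝ) ^ 2 := cast_sq_pos_of_neZero L
  rw [div_lt_iff₀ hL]
  have haL : 0 < a * (L : ℝ) ^ 2 := mul_pos ha hL
  by_cases hx0 : x ≤ 0
  · exact lt_of_le_of_lt hx0 haL
  push Not at hx0
  have ha2 : 0 < a ^ 2 := by positivity
  have hκpos : 0 < κ := lt_of_lt_of_le (div_pos (by positivity) ha2) hκ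
  have hceil := repelled_pairAmplitude_sq_le L R hR U μ h hκpos.le
  have hE := neg_groundEnergy_dWaveSourceTorus_le L U μ h hU
  have hc : 10 * (1 + U + |μ|) + 12 * |h| < κ * a ^ 2 := by
    have hh1 : |h| ≤ 1 := by rw [abs_of_nonneg hh.1]; exact hh.2
    have h2 : 10 * (1 + U + |μ|) + 13 ≤ κ * a ^ 2 := by rwa [div_le_iff₀ ha2] at hκ
    linarith
  have h3 : κ * x ^ 2 < κ * (a * (L : ℝ) ^ 2) ^ 2 :=
    calc κ * x ^ 2 ≤ -((L : ℝ) ^ 2 * (dWaveSourceTorus L U μ h).groundEnergy) := hceil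
      _ = (L : ℝ) ^ 2 * (-(dWaveSourceTorus L U μ h).groundEnergy) := by ring
      _ ≤ (L : ℝ) ^ 2 * ((10 * (1 + U + |μ|) + 12 * |h|) * (L : ℝ) ^ 2) := mul_le_mul_of_nonneg_left hE hL.le
      _ < (L : ℝ) ^ 2 * ((κ * a ^ 2) * (L : ℝ) ^ 2) :=
          mul_lt_mul_of_pos_left (mul_lt_mul_of_pos_right hc hL) hL
      _ = κ * (a * (L : ℝ) ^ 2) ^ 2 := by ring
  have h4 : x ^ 2 < (a * (L : ℝ) ^ 2) ^ 2 := lt_of_mul_lt_mul_left h3 hκpos.le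
  have h5 : |x| < a * (L : ℝ) ^ 2 := abs_lt_of_sq_lt_sq h4 haL.le
  exact (le_abs_self x).trans_lt h5

omit [NeZero L] in
/-- **The `∀κ` strengthening of S2 is incompatible with crux 2** (`CwChiralConstruction`): replacing `∃ κ > 0` by
`∀ κ > 0` in `stub_repelledOrderPersistence` yields a statement whose negation follows from the construction crux —
the construction supplies a guarded triple `(U, δ, μ)` (density matching + `HasDWaveOrder`), the strengthened stub a
floor `a`, and `repelled_pairDensity_lt_of_large_coupling` a coupling at which the floor fails at every side.
(Negative lemma on a STRENGTHENING of the stub; S2 itself is untouched.) [folklore] -/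
theorem forallKappa_repelledOrder_false_of_construction
    (hC : Summit.HubbardSuperconductivity.HubbardSuperconductivity.Theses.ChiralWindow.CwChiralConstruction) :
    ¬ (∃ U₀ : ℝ, 0 < U₀ ∧ ∀ U ∈ Set.Ioo (0:ℝ) U₀, ∀ δ ∈ Set.Ioo (0:ℝ) (1 / 2), ∀ μ : ℝ,
        Filter.Tendsto (fun L : ℕ => ((hubbardTorusWith 2 (L + 1) 1 U μ).groundStateFunctional totalNumber).re /
          ((L + 1 : ℕ) : ℝ) ^ 2) Filter.atTop (nhds (1 - δ)) → HasDWaveOrder U μ →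
        ∃ a : ℝ, 0 < a ∧ ∀ R : ℕ, 0 < R → ∀ κ : ℝ, 0 < κ → ∃ h₀ : ℝ, 0 < h₀ ∧ ∀ h ∈ Set.Ioo (0:ℝ) h₀,
          ∀ᶠ L : ℕ in Filter.atTop, a ≤ ((dWaveSourceTorus (L + 1) U μ h + (κ : ℂ) •
            (((((R : ℝ) ^ 4)⁻¹ : ℝ) : ℂ) • ∑ a : TorusSite 2 (L + 1),
              (∑ u : Fin 2 → Fin R, localPair dWaveFormFactor (L + 1) (a + fun i => ((u i : ℕ) : ZMod (L + 1))))ᴴ *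
                (∑ u : Fin 2 → Fin R,
                  localPair dWaveFormFactor (L + 1) (a + fun i => ((u i : ℕ) : ZMod (L + 1)))))).groundStateFunctional
            (pairField dWaveFormFactor (L + 1))).re / ((L + 1 : ℕ) : ℝ) ^ 2) := by
  rintro ⟨U₀, hU₀, H⟩
  obtain ⟨U₁, hU₁, C, -, hcon⟩ := hC
  set U : ℝ := min U₀ U₁ / 2 with hU_def
  have hmin : 0 < min U₀ U₁ := lt_min hU₀ hU₁
  have hUpos : 0 < U := by rw [hU_def]; linarith
  have hU0 : U ∈ Set.Ioo (0:ℝ) U₀ := ⟨hUpos, by rw [hU_def]; linarith [min_le_left U₀ U₁]⟩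
  have hU1 : U ∈ Set.Ioo (0:ℝ) U₁ := ⟨hUpos, by rw [hU_def]; linarith [min_le_right U₀ U₁]⟩
  obtain ⟨δ, hδ, μ, hDM, hfloor⟩ := hcon U hU1
  have hδ' : δ ∈ Set.Ioo (0:ℝ) (1 / 2) := ⟨by linarith [hδ.1], by linarith [hδ.2]⟩
  have hord : HasDWaveOrder U μ := lt_of_lt_of_le (Real.exp_pos _) hfloor
  obtain ⟨a, ha, Ha⟩ := H U hU0 δ hδ' μ hDM hord
  set κ : ℝ := (10 * (1 + U + |μ|) + 13) / a ^ 2 with hκ_def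
  have hκ : 0 < κ := by rw [hκ_def]; positivity
  obtain ⟨h₀, hh₀, Hh⟩ := Ha 1 one_pos κ hκ
  set h : ℝ := min (h₀ / 2) (1 / 2) with hh_def
  have hhpos : 0 < h := lt_min (by linarith) (by norm_num)
  have hh : h ∈ Set.Ioo (0:ℝ) h₀ := ⟨hhpos, (min_le_left _ _).trans_lt (by linarith)⟩
  have hh1 : h ∈ Set.Icc (0:ℝ) 1 := ⟨hhpos.le, (min_le_right _ _).trans (by norm_num)⟩
  obtain ⟨L, hL⟩ := (Hh h hh).exists
  have hlt := repelled_pairDensity_lt_of_large_coupling (L + 1) 1 one_pos hUpos.le μ hh1 ha (le_of_eq hκ_def.symm)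
  exact absurd hL (not_le.mpr hlt)

end KappaThreshold

/-! ### 2. Transfer B in the two-phase caricature of a coexistence point -/

section TransferBCaricature

/-- **At `κ = 0` the source selects the `B1g`-rich phase** for every `h > 0` (the `HasDWaveOrder` side of the
caricature: two phases of equal energy density, sourced energies `-2h mᵢ`, `m₂ < m₁`). [folklore] -/
theorem transferB_unrepelled_selects_rich {m₁ m₂ h : ℝ} (hm : m₂ < m₁) (hh : 0 < h) (w₁ w₂ : ℝ) :
    0 * w₁ - 2 * h * m₁ < 0 * w₂ - 2 * h * m₂ := by
  nlinarith

/-- **For every `κ > 0` the block-repelled sourced competition selects the block-POORER phase at small source**: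
with penalties `w₂ < w₁` and `2h(m₁ - m₂) < κ(w₁ - w₂)` the repelled sourced energy `-2h m₂ + κ w₂` of phase 2 is
strictly below that of phase 1. [folklore] -/
theorem transferB_repelled_selects_poor {m₁ m₂ w₁ w₂ h κ : ℝ} (hlt : 2 * h * (m₁ - m₂) < κ * (w₁ - w₂)) :
    κ * w₂ - 2 * h * m₂ < κ * w₁ - 2 * h * m₁ := by
  linarith

/-- **Transfer B fails at SC/normal coexistence** (the caricature with `m₂ = 0`): although the unrepelled source
selects the ordered phase for every `h > 0` (`transferB_unrepelled_selects_rich`), there is NO floor `a > 0`,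
coupling `κ > 0` and source window `(0, h₀)` on which the selected order of the repelled competition stays `≥ a`
— for every `κ > 0` the poor phase wins below `h* = κ(w₁ - w₂)/(2m₁)`. This is the shape
`∃ a > 0, (∀ R,) ∃ κ > 0, ∃ h₀ > 0, ∀ h ∈ (0,h₀), a ≤ …` of stub S2 at one scale. [folklore] -/
theorem transferB_fails_at_scNormal_coexistence {m₁ w₁ w₂ : ℝ} (hm : 0 < m₁) (hw : w₂ < w₁) :
    ¬ ∃ a : ℝ, 0 < a ∧ ∃ κ : ℝ, 0 < κ ∧ ∃ h₀ : ℝ, 0 < h₀ ∧ ∀ h ∈ Set.Ioo (0:ℝ) h₀,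
      a ≤ (if κ * w₁ - 2 * h * m₁ ≤ κ * w₂ - 2 * h * 0 then m₁ else 0) := by
  rintro ⟨a, ha, κ, hκ, h₀, hh₀, H⟩
  -- a source below both `h₀` and the switching point `h* = κ(w₁ - w₂)/(2m₁)`
  set hs : ℝ := κ * (w₁ - w₂) / (2 * m₁) with hs_def
  have hs_pos : 0 < hs := by rw [hs_def]; exact div_pos (mul_pos hκ (by linarith)) (by linarith)
  set h : ℝ := min (h₀ / 2) (hs / 2) with h_def
  have hpos : 0 < h := lt_min (by linarith) (by linarith)
  have hlt₀ : h < h₀ := (min_le_left _ _).trans_lt (by linarith)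
  have hlts : h < hs := (min_le_right _ _).trans_lt (by linarith)
  have key := H h ⟨hpos, hlt₀⟩
  have hswitch : ¬ (κ * w₁ - 2 * h * m₁ ≤ κ * w₂ - 2 * h * 0) := by
    intro hle
    have h1 : 2 * h * m₁ < κ * (w₁ - w₂) := by
      rw [hs_def, lt_div_iff₀ (by linarith)] at hlts
      linarith
    linarith
  rw [if_neg hswitch] at key
  linarith

/-- **Transfer B holds at SC/SC coexistence** (`0 < m₂ ≤ m₁`): whichever phase the repelled sourced competition
selects, the selected order is `≥ m₂ > 0` — for EVERY coupling and source, so the S2 shape holds with the floor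
`a = m₂` although the block-energy density is kinked there (Transfer A's `NoBlockKink` fails at the same point,
`coexistence_defeats_encoding`). [folklore] -/
theorem transferB_holds_at_scSc_coexistence {m₁ m₂ : ℝ} (hm : m₂ ≤ m₁) (w₁ w₂ κ h : ℝ) :
    m₂ ≤ (if κ * w₁ - 2 * h * m₁ ≤ κ * w₂ - 2 * h * m₂ then m₁ else m₂) := by
  split_ifs
  · exact hm
  · exact le_rfl

/-- The S2 shape at SC/SC coexistence, literally: a floor, a coupling and a source window exist. [folklore] -/
theorem transferB_shape_at_scSc_coexistence {m₁ m₂ : ℝ} (hm₂ : 0 < m₂) (hm : m₂ ≤ m₁) (w₁ w₂ : ℝ) :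
    ∃ a : ℝ, 0 < a ∧ ∃ κ : ℝ, 0 < κ ∧ ∃ h₀ : ℝ, 0 < h₀ ∧ ∀ h ∈ Set.Ioo (0:ℝ) h₀,
      a ≤ (if κ * w₁ - 2 * h * m₁ ≤ κ * w₂ - 2 * h * m₂ then m₁ else m₂) :=
  ⟨m₂, hm₂, 1, one_pos, 1, one_pos, fun h _ => transferB_holds_at_scSc_coexistence hm w₁ w₂ 1 h⟩

end TransferBCaricature

end Summit.HubbardSuperconductivity.HubbardSuperconductivity.Theorems.CwSsbToEvenTorusLRO.Negative

end
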